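import Summits.PneNP.PneNP.Theorems.ConvexRankGatesConvexGateBlindExactLiftingTriangleVertex

/-!
# Triangle instance — in ANY non-negative factorisation of `M_t`, every line indicator is an explicit signed combination of
# the generators (`B·V = Λ`)

Support file for crux `ConvexGateBlind` (stmt-PneNP-10680), open stub `stub_exactLifting`; prover seat 0, session 36,
memo ANALYSIS15 §4. The biorthogonal functionals `Φ_L` of `…TriangleVertex` read only four nondegenerate rows, and
`M_x = Σ_L [L mono_x] 1_L` holds for every row; applying `Φ_L` to an arbitrary factorisation `M_t = Σ_i u_i ⊗ v_i` (any index
type, any signs even) gives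
    `1_L(w) = Σ_i (Φ_L(u_i)/2) · v_i(w)`            (`lind_eq_sum_generators`),
i.e. `B·V = Λ` with `B_{L i} = Φ_L(u_i)/2`: the `3t²` line indicators lie in the linear span of the generators of EVERY
factorisation of `M_t` (`t ≥ 4`). Consequences recorded in the memo: `rank V ≥ 3t² − 3t + 1`; for `3t²`-term NMFs the usage
matrix is `U = N·B + K` with the rows of `K` in the left kernel of `V` (dimension `≤ 3t − 1`) — the parametrisation in which the
remaining analytic statement R1* (generators in `cone{1_L}`) is to be attacked. Registered sub-goal
`triangle_lines_in_generator_span` (self-contained signature).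
-/

set_option linter.dupNamespace false -- `Summit.PneNP.PneNP.…`: summit = sub-problem (D-0017)

namespace Summit.PneNP.PneNP.Theorems.XorDoor.TriLine

open Finset

noncomputable section

variable {t : ℕ} {ι : Type} [Fintype ι]

/-- **`B·V = Λ`**: for any factorisation `Σ_i u_i(x) v_i(w) = M_t[x,w]` (all rows), every line indicator is the signed
combination `1_L = Σ_i (Φ_L(u_i)/2) v_i` of the generators. -/
theorem lind_eq_sum_generators (ht : 4 ≤ t) {u : ι → Col t → ℝ} {v : ι → Tri t → ℝ}
    (hfact : ∀ x w, ∑ i, u i x * v i w = (monoCount x w : ℝ)) (L : Line t) (w : Tri t) :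
    lind L w = ∑ i, lfun ht L (u i) / 2 * v i w := by
  -- apply `Φ_L` to `y ↦ M_y(w)` written in the two ways
  have h1 : lfun ht L (fun y => ∑ i, v i w * u i y) = ∑ i, v i w * lfun ht L (u i) := lfun_sum univ ht L _ _
  have h2 : lfun ht L (fun y => ∑ L', lind L' w * mInd y L') = ∑ L', lind L' w * lfun ht L (fun y => mInd y L') :=
    lfun_sum univ ht L _ _
  have h12 : lfun ht L (fun y => ∑ i, v i w * u i y) = lfun ht L (fun y => ∑ L', lind L' w * mInd y L') := by
    refine lfun_congr ht L fun y _ => ?_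
    calc ∑ i, v i w * u i y = ∑ i, u i y * v i w := sum_congr rfl fun i _ => mul_comm _ _
      _ = (monoCount y w : ℝ) := hfact y w
      _ = ∑ L', mInd y L' * lind L' w := (sum_mInd_mul_lind y w).symm
      _ = ∑ L', lind L' w * mInd y L' := sum_congr rfl fun L' _ => mul_comm _ _
  rw [h1, h2] at h12
  have h3 : ∑ L', lind L' w * lfun ht L (fun y => mInd y L') = 2 * lind L w := by
    rw [sum_congr rfl fun L' _ => by rw [lfun_mInd ht L L'], Fintype.sum_eq_single L]
    · rw [if_pos rfl]; ring
    · intro L' hL'; rw [if_neg hL', mul_zero]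
  rw [h3] at h12
  calc lind L w = (∑ i, v i w * lfun ht L (u i)) / 2 := by rw [h12]; ring
    _ = ∑ i, lfun ht L (u i) / 2 * v i w := by rw [sum_div]; exact sum_congr rfl fun i _ => by ring

/-- **Every line indicator lies in the span of the generators of any factorisation of the triangle matrix** (registered
sub-goal `triangle_lines_in_generator_span` of stmt-PneNP-10680, verbatim signature, self-contained vocabulary): for `t ≥ 4`,
if `Σ_i u_i(x) v_i(w) = M_t[x,w]` for all rows `x` (three `2`-colourings of `Fin t`) and transversal triangles `w`, with `R`
terms and no sign condition, then for every line `L` (type `(Fin t × Fin t) ⊕ (Fin t × Fin t) ⊕ (Fin t × Fin t)`, membership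
written out with `Sum.elim`) there are coefficients `c` with `1_L = Σ_i c_i v_i`. -/
theorem triangle_lines_in_generator_span : ∀ (t R : ℕ), 4 ≤ t → ∀ (u : Fin R → (Fin t → Bool) × (Fin t → Bool) × (Fin t
    → Bool) → ℝ) (v : Fin R → Fin t × Fin t × Fin t → ℝ), (∀ (x : (Fin t → Bool) × (Fin t → Bool) × (Fin t → Bool)) (w :
    Fin t × Fin t × Fin t), ∑ i, u i x * v i w = ((if x.1 w.1 = x.2.1 w.2.1 then 1 else 0) + (if x.1 w.1 = x.2.2 w.2.2
    then 1 else 0) + (if x.2.1 w.2.1 = x.2.2 w.2.2 then 1 else 0) : ℝ)) → ∀ L : (Fin t × Fin t) ⊕ (Fin t × Fin t) ⊕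
    (Fin t × Fin t), ∃ c : Fin R → ℝ, ∀ w : Fin t × Fin t × Fin t, Sum.elim (fun ab : Fin t × Fin t => if w.1 = ab.1 ∧
    w.2.1 = ab.2 then (1 : ℝ) else 0) (Sum.elim (fun ad : Fin t × Fin t => if w.1 = ad.1 ∧ w.2.2 = ad.2 then (1 : ℝ)
    else 0) (fun bd : Fin t × Fin t => if w.2.1 = bd.1 ∧ w.2.2 = bd.2 then (1 : ℝ) else 0)) L = ∑ i, c i * v i w := by
  intro t R ht u v hfact L
  have hf : ∀ x w, ∑ i, u i x * v i w = (monoCount x w : ℝ) := by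
    intro x w; rw [hfact x w]; simp only [monoCount]; push_cast; ring
  exact ⟨fun i => lfun ht L (u i) / 2, fun w => by rw [← lind_eq_elim, lind_eq_sum_generators ht hf L w]⟩

end

end Summit.PneNP.PneNP.Theorems.XorDoor.TriLine
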